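import Mathlib
import HarnessLib
import Literature.Computability.AlgebraicComplexity.PatternExpressions
import Literature.Combinatorics.SimpleGraph.TreeDecomposition
import Literature.Combinatorics.SimpleGraph.Bramble
import Literature.Combinatorics.SimpleGraph.TreewidthBrambleLowerBound
import Summits.ValiantsHypothesis.ValiantsHypothesis.Theorems.MonotoneRestorationMonotoneRestorationQPLinearWidthForestBlind

/-!
# Route MonotoneRestoration, crux `MonotoneRestorationQP` (stmt-15886), line `linear-width` —
# `HomIndist n 2` IS NOT ISOMORPHISM: the forest-blind pair of `…LinearWidthForestBlind.lean` in the
# line's verbatim vocabulary (treewidth `< 2` patterns are acyclic)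

Helper file (`--supports stmt-ValiantsHypothesis-15886`), def-free; sequel of
`Theorems/…LinearWidthForestBlind.lean`, which proved that acyclic bipartite multigraph patterns do not
separate row/column-equidistributed matrices and exhibited the pair (`8`-cycle, two `4`-cycles) at
level `4`.  The line's `HomIndist n k` quantifies over patterns whose pattern graph has TREEWIDTH `< k`;
this file supplies the graph-theoretic bridge and restates the result verbatim:

* `isAcyclic_of_treewidth_lt_two` — a finite graph of treewidth `< 2` is acyclic: a non-bridge edge
  `uv` and a `u`–`v` path avoiding it give the bramble `{{u}, {v}, interior}` which no two vertices
  cover, so `tw ≥ 2` by `le_treewidth_of_isBramble` (the easy direction of treewidth duality, in tree);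
* `homIndist_two_of_equidistributed` — row/column-equidistributed matrices are `HomIndist n 2`
  (unfolded verbatim);
* `exists_homIndist_two_not_perms` — **at level `n = 4` there are `A, B` with `HomIndist 4 2 A B` that
  are NOT in the same `Sym_4 × Sym_4`-orbit**: the bottom nontrivial level `k = 2` of the width scale
  is strictly coarser than isomorphism (contrast: `k = 1` is trivial, `DeterminedVsNarrow.homIndist_one`;
  `k ≥ 4·(n!)²` is isomorphism, `OrbitSeparation.homIndist_iff_exists_perms`).

Honest label: calibration (classical: colour refinement / treewidth-1 homomorphism counts do not
determine a weighted bipartite graph); no stub closed; VP ≠ VNP not moved.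
[cite: DwivediPagoSeppelt2026, Def. 3.2] [cite: Diestel2010, Thm 12.3.6]
-/

-- `Summit.ValiantsHypothesis.ValiantsHypothesis.…` is the tree's mandated namespace (Sub = Summit).
set_option linter.dupNamespace false

noncomputable section

namespace Summit.ValiantsHypothesis.ValiantsHypothesis.Theorems

namespace ForestBlind

open Literature.Computability.AlgebraicComplexity MvPolynomial SimpleGraph
open Literature.Combinatorics.SimpleGraph

/-- **A graph of treewidth `< 2` is acyclic**: a cycle `u v w_k ⋯ w₁ u` carries the bramble
`{{u}, {v}, {w_1, …, w_k}}` of order `3`, so `tw ≥ 2` (`le_treewidth_of_isBramble`).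
[cite: Diestel2010, Thm 12.3.6 (easy direction)] -/
theorem isAcyclic_of_treewidth_lt_two {V : Type*} [Fintype V] [DecidableEq V] (G : SimpleGraph V)
    (h : treewidth G < 2) : G.IsAcyclic := by
  classical
  by_contra hG
  rw [isAcyclic_iff_forall_adj_isBridge] at hG
  push Not at hG
  obtain ⟨u, v, huv, hbr⟩ := hG
  rw [isBridge_iff_forall_walk_mem_edges] at hbr
  push Not at hbr
  obtain ⟨p, hp⟩ := hbr
  -- a `u`–`v` path avoiding the edge `uv`
  have hPpath : (p.toPath : G.Walk u v).IsPath := p.toPath.2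
  have hPe : s(u, v) ∉ (p.toPath : G.Walk u v).edges := fun he =>
    hp (Walk.edges_toPath_subset_edges p he)
  have hnodup : (p.toPath : G.Walk u v).support.Nodup := hPpath.support_nodup
  generalize (p.toPath : G.Walk u v) = P at hPpath hPe hnodup
  -- decompose `P = u → w₁ ⇝ v`
  cases P with
  | nil => exact huv.ne rfl
  | @cons _ w₁ _ h₁ P₁ =>
    rw [Walk.support_cons, List.nodup_cons] at hnodup
    -- decompose the reverse of `P₁ : w₁ ⇝ v` as `v → w_k ⇝ w₁`
    have hnodup₁ : P₁.reverse.support.Nodup := by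
      rw [Walk.support_reverse]; exact List.nodup_reverse.2 hnodup.2
    have hu₁ : u ∉ P₁.reverse.support := by
      rw [Walk.support_reverse, List.mem_reverse]; exact hnodup.1
    generalize hR : P₁.reverse = R at hnodup₁ hu₁
    cases R with
    | nil =>
      -- then `P = u → v`, using the edge `uv`
      have : P₁ = Walk.nil := by
        have := congrArg Walk.reverse hR
        simpa using this
      subst this
      exact hPe (by simp)
    | @cons _ wk _ h₂ Q =>
      rw [Walk.support_cons, List.nodup_cons] at hnodup₁
      rw [Walk.support_cons, List.mem_cons, not_or] at hu₁
      -- the interior `S = support of Q : w_k ⇝ w₁`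
      let S : Set V := {z | z ∈ Q.support}
      have hwk : wk ∈ S := Q.start_mem_support
      have hw₁ : w₁ ∈ S := Q.end_mem_support
      have huS : u ∉ S := hu₁.2
      have hvS : v ∉ S := hnodup₁.1
      have hSconn : IsConnectedSet G S := by
        refine ⟨⟨wk, hwk⟩, fun a ha b hb => ?_⟩
        refine ⟨((Q.takeUntil a ha).reverse).append (Q.takeUntil b hb), fun z hz => ?_⟩
        rw [Walk.support_append, List.mem_append, Walk.support_reverse, List.mem_reverse] at hz
        rcases hz with hz | hz
        · exact Q.support_takeUntil_subset_support ha hz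
        · exact Q.support_takeUntil_subset_support hb (List.tail_subset _ hz)
      -- the bramble `{ {u}, {v}, S }`
      have hℬ : IsBramble G ({{u}, {v}, S} : Set (Set V)) := by
        refine ⟨?_, ?_⟩
        · intro B hB
          simp only [Set.mem_insert_iff, Set.mem_singleton_iff] at hB
          rcases hB with rfl | rfl | rfl
          · exact isConnectedSet_singleton u
          · exact isConnectedSet_singleton v
          · exact hSconn
        · have tuv : Touches G {u} {v} := Or.inr ⟨u, rfl, v, rfl, huv⟩
          have tuS : Touches G {u} S := Or.inr ⟨u, rfl, w₁, hw₁, h₁⟩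
          have tvS : Touches G {v} S := Or.inr ⟨v, rfl, wk, hwk, h₂⟩
          have self : ∀ B : Set V, B.Nonempty → Touches G B B := fun B hB =>
            Or.inl (by rwa [Set.inter_self])
          intro B hB B' hB'
          simp only [Set.mem_insert_iff, Set.mem_singleton_iff] at hB hB'
          rcases hB with rfl | rfl | rfl <;> rcases hB' with rfl | rfl | rfl
          · exact self _ ⟨u, rfl⟩
          · exact tuv
          · exact tuS
          · exact tuv.symm
          · exact self _ ⟨v, rfl⟩
          · exact tvS
          · exact tuS.symm
          · exact tvS.symm
          · exact self _ ⟨wk, hwk⟩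
      -- no two vertices cover it
      have hk : ∀ X : Set V, X.encard ≤ ((2 : ℕ) : ℕ∞) → ¬ Covers X ({{u}, {v}, S} : Set (Set V)) := by
        intro X hX hcov
        obtain ⟨u', hu'⟩ := hcov (B := {u}) (by simp)
        obtain ⟨v', hv'⟩ := hcov (B := {v}) (by simp)
        obtain ⟨s, hs⟩ := hcov (B := S) (by simp)
        rw [Set.mem_inter_iff, Set.mem_singleton_iff] at hu' hv'
        obtain ⟨rfl, huX⟩ := hu'
        obtain ⟨rfl, hvX⟩ := hv'
        have hsu : s ≠ u' := fun h => huS (h ▸ hs.1)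
        have hsv : s ≠ v' := fun h => hvS (h ▸ hs.1)
        have h3 : ({u', v', s} : Set V).encard = 3 := by
          rw [Set.encard_insert_of_notMem, Set.encard_pair hsv.symm]
          · norm_num
          · simp only [Set.mem_insert_iff, Set.mem_singleton_iff, not_or]
            exact ⟨huv.ne, hsu.symm⟩
        have hsub : ({u', v', s} : Set V) ⊆ X := by
          intro z hz
          simp only [Set.mem_insert_iff, Set.mem_singleton_iff] at hz
          rcases hz with rfl | rfl | rfl
          · exact huX
          · exact hvX
          · exact hs.2
        have := (Set.encard_le_encard hsub).trans hX
        rw [h3, Nat.cast_ofNat] at this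
        norm_num at this
      have h2 : 2 ≤ treewidth G := le_treewidth_of_isBramble hℬ hk
      omega

/-- **Row/column-equidistributed matrices are `HomIndist n 2`** (line `linear-width`, unfolded
verbatim). [folklore] -/
theorem homIndist_two_of_equidistributed {n : ℕ} (A B : Fin n × Fin n → ℂ)
    (hrow : ∀ (m : ℕ) (i i' : Fin n), ∑ j, A (i, j) ^ m = ∑ j, B (i', j) ^ m)
    (hcol : ∀ (m : ℕ) (j j' : Fin n), ∑ i, A (i, j) ^ m = ∑ i, B (i, j') ^ m) :
    ∀ (a b : ℕ) (E : Multiset (Fin a × Fin b)),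
      Literature.Combinatorics.SimpleGraph.treewidth
        (SimpleGraph.fromRel fun u v : Fin a ⊕ Fin b => ∃ p ∈ E, u = Sum.inl p.1 ∧ v = Sum.inr p.2) < 2 →
      eval A (homPoly E n ℂ) = eval B (homPoly E n ℂ) := by
  classical
  exact fun a b E hE =>
    eval_homPoly_eq_of_isAcyclic A B hrow hcol a b E (isAcyclic_of_treewidth_lt_two _ hE)

/-- **`HomIndist 4 2` is not isomorphism.**  There are `A, B ∈ ℂ^{4×4}` (the biadjacency matrices of
the `8`-cycle and of two `4`-cycles) with `HomIndist 4 2 A B` (unfolded verbatim) such that `B` is not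
a row/column permutation of `A`. [folklore] -/
theorem exists_homIndist_two_not_perms :
    ∃ A B : Fin 4 × Fin 4 → ℂ,
      (∀ (a b : ℕ) (E : Multiset (Fin a × Fin b)),
        Literature.Combinatorics.SimpleGraph.treewidth
          (SimpleGraph.fromRel fun u v : Fin a ⊕ Fin b =>
            ∃ p ∈ E, u = Sum.inl p.1 ∧ v = Sum.inr p.2) < 2 →
        eval A (homPoly E 4 ℂ) = eval B (homPoly E 4 ℂ)) ∧
      ∀ σ τ : Equiv.Perm (Fin 4), B ≠ fun ij : Fin 4 × Fin 4 => A (σ ij.1, τ ij.2) := by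
  classical
  obtain ⟨A, B, hAB, hne⟩ := exists_nonisomorphic_forestBlind_pair
  exact ⟨A, B, fun a b E hE => hAB a b E (isAcyclic_of_treewidth_lt_two _ hE), hne⟩

end ForestBlind

end Summit.ValiantsHypothesis.ValiantsHypothesis.Theorems

end
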